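import Summits.QuantumAdvantage.AdviceFreeQNC0.SparseOfGap
import Summits.QuantumAdvantage.AdviceFreeQNC0.WalkTubeRank
import HarnessLib

/-!
# Cell qa-qnc0 (odd primes `p ≥ 5`, rung R2 from R4): `WalkHardFAnchored p` — one window, non-local selections

Planner qa-qnc0-p2 g13, ROUND-13 §2 rung R2 / `line13/Sketch13p2.lean` §3 (statements `Anchored`, `WalkHardFAnchored p`
VERBATIM; remark (a) there: "R2 ⊂ R4 (s ≤ w = polylog)").  PROVED here (bookkeeping only, every `p`):

* **`walkHardFAnchored_of_sparse : WalkHardFSparse p → WalkHardFAnchored p`** — a strategy whose active cuts stay in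
  ONE window `[g₀, g₀ + (log₂ n)^C)` has at most `(log₂ n)^C` potentially-active cuts, so the sparse rung R4
  (`WalkHardFSparse p`, `SparseOfGap.lean`) applies as soon as `(log₂ n)^{5C+3} ≤ n`
  (`TubePlanProof.logPow_le_natSqrt`).

So the chain for `p ≥ 5` reads `elimLevelSqrtF` (g10) ⇒ R3 `WalkHardFGap` (`WalkHardFGap.lean`) ⇒ R4 `WalkHardFSparse`
(`sparseOfGap`) ⇒ R2 `WalkHardFAnchored` (this file).  WHAT THIS IS NOT: the selections here may read the whole input
but the ACTIVE cuts are confined to one polylog window; the dense non-local crux `WalkHardF p` is untouched;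
separation NOT moved.
-/

noncomputable section

namespace Summit.QuantumAdvantage.AdviceFreeQNC0

open Classical
open Finset

variable {n : ℕ}

/-! ### Statements (planner qa-qnc0-p2 Sketch13p2 §3, verbatim) -/

/-- All active cuts lie in the window `[g₀, g₀ + w)`. (Selections `y g` may depend on ALL of `u`.)
(Sketch13p2 §3, verbatim.) -/
def Anchored (g₀ w : ℕ) (y : Fin (n + 1) → (Fin n → Bool) → Bool) : Prop :=
  ∀ g : Fin (n + 1), ∀ u : Fin n → Bool, y g u = true → g₀ ≤ g.val ∧ g.val < g₀ + w

/-- **`WalkHardFAnchored p`** (M): strategies whose active cuts stay in ONE window of width `(log₂ n)^C`, with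
`𝔽_p`-degree-`(log₂ n)^C` selections depending on the whole input, win at most `θ·2ⁿ`, one `θ < 1` for all `C`.
Mechanism (ROUND-13 §3): by `AvoidNormalForm` the win set is `{u : s_{g₀}(u) ≠ e(u)}` with `e(u)` determined by the
window's relative odd-parity pattern (low-degree level sets) and `s_{g₀}(u) = c + |u ⊕ 1_{[0,g₀)}| mod 3` — the
ELIMINATION game for a Hamming weight mod 3 against `𝔽_p`-low-degree level sets (`ElimHardF p`, robust Hegedűs over
`𝔽_p` with shifts `q = p^j ≢ 0 (mod 3)`).  PROVED (from R4): `walkHardFAnchored_of_sparse`. (Sketch13p2 §3, verbatim.) -/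
def WalkHardFAnchored (p : ℕ) [Fact p.Prime] : Prop :=
  ∃ θ : ℝ, θ < 1 ∧ ∀ C : ℕ, ∃ n₀ : ℕ, ∀ n ≥ n₀, ∀ c g₀ : ℕ, ∀ y : Fin (n + 1) → (Fin n → Bool) → Bool,
    Anchored g₀ ((Nat.log 2 n) ^ C) y → (∀ g, HasDegF p (y g) ((Nat.log 2 n) ^ C)) →
      ((univ.filter fun u : Fin n → Bool => ringWinU c y u = true).card : ℝ) ≤ θ * (2 : ℝ) ^ n

/-! ### R2 from R4 -/

/-- An anchored strategy has at most `w` potentially-active cuts. -/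
theorem card_activeCuts_le_of_anchored {g₀ w : ℕ} {y : Fin (n + 1) → (Fin n → Bool) → Bool}
    (h : Anchored g₀ w y) : (activeCuts y).card ≤ w := by
  calc (activeCuts y).card ≤ (Finset.range w).card := by
        refine Finset.card_le_card_of_injOn (fun g => g.val - g₀) (fun g hg => ?_) (fun g hg g' hg' hgg' => ?_)
        · rw [Finset.mem_coe] at hg
          unfold activeCuts at hg
          rw [mem_filter] at hg
          obtain ⟨u, hu⟩ := hg.2
          have := h g u hu
          rw [Finset.mem_coe, Finset.mem_range]
          show g.val - g₀ < w
          omega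
        · rw [Finset.mem_coe] at hg hg'
          unfold activeCuts at hg hg'
          rw [mem_filter] at hg hg'
          obtain ⟨u, hu⟩ := hg.2
          obtain ⟨u', hu'⟩ := hg'.2
          have h1 := h g u hu
          have h2 := h g' u' hu'
          have h3 : g.val - g₀ = g'.val - g₀ := hgg'
          exact Fin.ext (by omega)
    _ = w := Finset.card_range w

/-- **R2 from R4: `WalkHardFSparse p → WalkHardFAnchored p`** (same `θ`; `(log₂ n)^{5C+3} ≤ n` eventually). -/
theorem walkHardFAnchored_of_sparse (p : ℕ) [Fact p.Prime] (h : WalkHardFSparse p) : WalkHardFAnchored p := by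
  obtain ⟨θ, hθ, hS⟩ := h
  refine ⟨θ, hθ, fun C => ?_⟩
  obtain ⟨n₀, hn₀⟩ := hS C
  obtain ⟨n₁, hn₁⟩ := TubePlanProof.logPow_le_natSqrt (5 * C + 3)
  refine ⟨max n₀ n₁, fun n hn c g₀ y hanch hdeg => hn₀ n (le_trans (le_max_left _ _) hn) c y hdeg ?_⟩
  have hs : (activeCuts y).card ≤ (Nat.log 2 n) ^ C := card_activeCuts_le_of_anchored hanch
  calc (activeCuts y).card ^ 3 * (Nat.log 2 n) ^ (2 * C + 3)
      ≤ ((Nat.log 2 n) ^ C) ^ 3 * (Nat.log 2 n) ^ (2 * C + 3) :=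
        Nat.mul_le_mul_right _ (Nat.pow_le_pow_left hs 3)
    _ = (Nat.log 2 n) ^ (5 * C + 3) := by rw [← pow_mul, ← pow_add]; ring_nf
    _ ≤ Nat.sqrt n := hn₁ n (le_trans (le_max_right _ _) hn)
    _ ≤ n := Nat.sqrt_le_self n

end Summit.QuantumAdvantage.AdviceFreeQNC0

end
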